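import Summits.Ventures.CertifiedManyBodySolver.Observables.MeanFieldClassExclusionLaLowU
import Literature.MathematicalPhysics.QuantumLattice.HubbardFermiSeaTangentRows
import Literature.MathematicalPhysics.QuantumLattice.HubbardFermiSeaTangentRowsDeepColumns
import Literature.MathematicalPhysics.QuantumLattice.HubbardFermiSeaTangentRowsBoxEnds
import HarnessLib

/-!
# Ventures/CertifiedManyBodySolver — Observables/MeanFieldClassExclusionObjectESlio.lean

HONEST FRAMING: first certified bounds; not a superconductivity verdict; every number certified or labelled float.
A competing-order EXCLUSION removes a named class of candidate ground states; it never says which order is present;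
no phase sentence follows.

Cell `hubbard-tc` (MO-S3, D-0096), seat `hubbard-tc-mod-3` (G3: competing orders as exclusion inputs from certified energy ORDERINGS),
`prover-hubbard-tc-mod-3-g5-0`. The MF/BCS-class word for the NEW S1 column **M29 = Sr₂₋ₓLaₓIrO₄ x = 0.10** (VSET #29, negative control
«no SC ≥ 2 K in bulk»; S1 box of record #58, `BOXES/Sr2IrO4.md` §OF-RECORD v1 2026-08-27T05:12Z: one-band `J_eff = ½` object, electron side
`n ∈ [1.09, 1.11]`, `t′/t ∈ [+0.18, +0.33]`, `U/t ∈ [7.6, 14.6]`). The `t–t′–U` Hubbard model on the bipartite square lattice is mapped by the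
particle–hole transformation to its PH IMAGE `n ↦ 2 − n`, `t′ ↦ −t′` (energies shift by `U(n − 1)`, the double occupancy by `n − 1`, and
quasi-free states go to quasi-free states), so the word is stated — like every cell row for this column (p1 `slioBoxEph_x010_le_decimal`,
TC-TABLE C-SLIO010(E)) — on the IMAGE face

  `t = 1`, `t′ ∈ [−7/20, −17/100] ⊇ [−0.33, −0.18]`, `n ∈ [89/100, 91/100]`, EVERY `U ≥ 5.9` (⊇ the box `[7.6, 14.6]`):

for every torus limit `ω` of unit `(rectN n L, S^z = 0)`-sector ground states of `hubbardTorusTT' L 1 t′ U`, `Re ω(n_{0↑} n_{0↓}) < (n/2)²`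
(`slioE_x010_docc_lt_of`) — no such ground state is a non-magnetic Hartree–Fock / singlet-BCS state (Wick: those have `docc ≥ (n/2)²`;
the identification is the docstring's reading, the THEOREM is the strict docc inequality). No registry word covered this face before
(`laLow_x007_docc_lt_of` is `n ∈ [0.91, 0.95]`, `laLow_x0125_docc_lt_of` is `n ≤ 0.895`, both on `t′ ∈ [−0.30, −0.20]` only).

Proof = the devices of `MeanFieldClassExclusionLaLowU.lean`, no new mathematics: CAP at `U_c = 6` = the ring-normalised density chord
`7/8 → 1` (`laLow_chord_78_one`, convexity in `n`) of the CERTIFIED #445 anchor `(8, 7/8, −1/4)` transported in `t′` by the decimal kinematic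
law and down to `U_c = 6` by monotonicity (`laLow_cap78_far` on `t′ ≤ −1/4`, `laLow_cap78_near` on `t′ ≥ −1/4`) and the CERTIFIED #21
half-filling cap at `U = 6` (`laLow_halfFilling_cap6`, valid at every `t′` since `t′ ↦ e(1, t′, U, 1)` is even and concave); FLOOR at
`U₀ = 0` = kernel tangent Fermi-sea rows touching at `n₀ = 9/10` in the columns `t′ ∈ {−7/20, −3/10, −1/5, −17/100}` and at `n₀ = 7/8` in
the column `−1/4` (`HubbardFermiSeaTangentRowsDeepColumns` / `…TangentRows` / `…BoxEnds` / `…LowB`), read between consecutive columns by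
concavity (`objE_floor_between`, min form); TAIL = `doccN_lt_of_capUc_threshold` with `U₁ = 5.9 ≤ U_c = 6` (one linear margin
`u − ℓ < (n/2)²·U₁`; `(n/2)²` read above its tangent at `n = 89/100`); the bilinear `(n, t′)` chord terms are closed by `nlinarith` with the
four McCormick products of each leaf rectangle. Exact leaf margins (designer `hubbard-tc-mod-3/g5-replay/m29_design.py`, Fractions):
`+0.126` (`[−7/20, −3/10]`), `+0.199` (`[−3/10, −1/4]`), `+0.199` (`[−1/4, −1/5]`), `+0.154` (`[−1/5, −17/100]`), all at the corner
`n = 0.89`. Conditional on the claim nodes #445 ∧ #21 BY HYPOTHESIS; everything else is a proved tree theorem.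
WHAT THIS IS NOT: a statement about the `J_eff = ½` projection's validity, about magnetism in Sr₂IrO₄, or about T_c; the saturated-FM class;
tight; a phase word.

References: T. Koma, H. Tasaki, J. Stat. Phys. 76 (1994) 745, §1 [KomaTasaki1994]; V. Bach, E. H. Lieb, J. P. Solovej,
J. Stat. Phys. 76 (1994) 3, eq. (2c.36) [BachLiebSolovej1994]; E. H. Lieb, M. Loss, Duke Math. J. 71 (1993) 337, §8 Thm 8.2
[LiebLoss1993]; R. B. Israel, Convexity in the Theory of Lattice Gases (1979), Thm I.3.4 [Israel1979]; D. Ruelle,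
Statistical Mechanics (1969) §3.3 [Ruelle1969].
-/

noncomputable section

namespace Summit.Ventures.CertifiedManyBodySolver.Observables

open Literature.MathematicalPhysics.QuantumLattice
open Literature.MathematicalPhysics.QuantumLattice.ThermodynamicLimit
open Summit.Ventures.CertifiedManyBodySolver.Certificates
open Matrix HubbardWave0 Literature.Probability.LatticeModels Filter Topology
open scoped ComplexOrder BigOperators

/-- **Sr₂₋ₓLaₓIrO₄ x = 0.10 (VSET M29, S1 box #58), PH-image OBJECT-E face `t′ ∈ [−7/20, −17/100]` × `n ∈ [0.89, 0.91]` — MF/BCS class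
excluded at EVERY `U ≥ 5.9` (⊇ the box `U/t ∈ [7.6, 14.6]`):** assume the claim nodes of CERTIFIED #445 (`cert_dbt329pair_allk`) and #21
(`cert_r21_luc_tl_upper_n1_U6`); then for `t′ ∈ [−7/20, −17/100]`, `U ≥ 59/10`, `n ∈ [89/100, 91/100]` every GS torus limit has
`Re ω(n_{0↑}n_{0↓}) < (n/2)²`. Cap at `U_c = 6` = chord `7/8 → 1` (#445 transported, #21); floor = tangent rows at `n₀ = 9/10`
(columns `−7/20, −3/10, −1/5, −17/100`) and `n₀ = 7/8` (column `−1/4`); four `t′`-pieces; smallest exact margin `+0.126`.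
[cite: KomaTasaki1994, §1] [cite: BachLiebSolovej1994, eq. (2c.36)] [cite: LiebLoss1993, §8, Theorem 8.2] -/
theorem slioE_x010_docc_lt_of (h445 : cert_dbt329pair_allk) (h21 : cert_r21_luc_tl_upper_n1_U6)
    {t' U n : ℝ} (ht1 : -7 / 20 ≤ t') (ht2 : t' ≤ -17 / 100) (hU : 59 / 10 ≤ U)
    (hn1 : 89 / 100 ≤ n) (hn2 : n ≤ 91 / 100) :
    ∀ (ω : InfVolFermionState 2) (Ls : ℕ → ℕ) (ψ : ∀ L, Fock (Orb (FermionTorus 2 L))),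
      Tendsto Ls atTop atTop →
      (∀ j, IsGroundStateInSector (hubbardTorusTT' (Ls j) 1 t' U) (rectN n (Ls j)) 0 (ψ (Ls j))) →
      (∀ j, star (ψ (Ls j)) ⬝ᵥ ψ (Ls j) = 1) → ω.IsTorusLimitOf ψ Ls →
      (ω.expect ({0} : Finset (Site 2))
        (nAt 0 (Finset.mem_singleton_self 0) 0 * nAt 0 (Finset.mem_singleton_self 0) 1)).re < (n / 2) ^ 2 := by
  have hn0 : (0 : ℝ) ≤ n := by linarith
  have hn2' : n < 2 := by linarith
  have h78 : (7 / 8 : ℝ) < n := by linarith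
  have h1 : n < 1 := by linarith
  -- the class constant `(n/2)²` above its tangent at the lower band edge, scaled by the threshold
  have hsq : (-7921 / 40000 : ℝ) + 89 / 200 * n ≤ (n / 2) ^ 2 := by nlinarith [sq_nonneg (n - 89 / 100)]
  have hsqU : ((-7921 / 40000 : ℝ) + 89 / 200 * n) * (59 / 10) ≤ (n / 2) ^ 2 * (59 / 10) :=
    mul_le_mul_of_nonneg_right hsq (by norm_num)
  have h6 : (0 : ℝ) ≤ 6 := by norm_num
  have hC := laLow_halfFilling_cap6 h21 t'
  -- the five kernel Fermi-sea columns at U₀ = 0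
  have ra := fermiSeaTangentRow_tPrime_neg_seven_div_twenty_at_nine_div_ten (U := 0) le_rfl hn0 hn2'
  have rb := fermiSeaTangentRow_tPrime_neg_three_div_ten_at_nine_div_ten (U := 0) le_rfl hn0 hn2'
  have rc := fermiSeaTangentRow_tPrime_neg_one_div_four_at_seven_div_eight (U := 0) le_rfl hn0 hn2'
  have rd := fermiSeaTangentRow_tPrime_neg_one_div_five_at_nine_div_ten (U := 0) le_rfl hn0 hn2'
  have re := fermiSeaTangentRow_tPrime_neg_seventeen_div_hundred_at_nine_div_ten (U := 0) le_rfl hn0 hn2'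
  rcases le_or_gt t' (-1 / 4) with hp | hp
  · -- far side of the anchor: cap `−1.0919417849 − 1.6212·t′` at `n = 7/8`
    have hA := laLow_cap78_far h445 h6 (by norm_num) hp
    have hcap := laLow_chord_78_one (n := n) h6 hA hC h78 h1
    rcases le_or_gt t' (-3 / 10) with hq | hq
    · -- piece `[-7/20, -3/10]`
      have hfl := objE_floor_between hn0 hn2' (by norm_num : (-7 / 20 : ℝ) ≤ -3 / 10) ra rb ht1 hq
      exact doccN_lt_of_capUc_threshold (U₁ := 59 / 10) (Uc := 6) (by norm_num) (by norm_num) hU hn0 hn2' hcap hfl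
        (sub_min_lt_of
          (by nlinarith only [mul_nonneg (sub_nonneg.2 hn1) (sub_nonneg.2 ht1), mul_nonneg (sub_nonneg.2 hn1) (sub_nonneg.2 hq),
            mul_nonneg (sub_nonneg.2 hn2) (sub_nonneg.2 ht1), mul_nonneg (sub_nonneg.2 hn2) (sub_nonneg.2 hq), hsqU])
          (by nlinarith only [mul_nonneg (sub_nonneg.2 hn1) (sub_nonneg.2 ht1), mul_nonneg (sub_nonneg.2 hn1) (sub_nonneg.2 hq),
            mul_nonneg (sub_nonneg.2 hn2) (sub_nonneg.2 ht1), mul_nonneg (sub_nonneg.2 hn2) (sub_nonneg.2 hq), hsqU]))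
    · -- piece `(-3/10, -1/4]`
      have hfl := objE_floor_between hn0 hn2' (by norm_num : (-3 / 10 : ℝ) ≤ -1 / 4) rb rc hq.le hp
      exact doccN_lt_of_capUc_threshold (U₁ := 59 / 10) (Uc := 6) (by norm_num) (by norm_num) hU hn0 hn2' hcap hfl
        (sub_min_lt_of
          (by nlinarith only [mul_nonneg (sub_nonneg.2 hn1) (sub_nonneg.2 hq.le), mul_nonneg (sub_nonneg.2 hn1) (sub_nonneg.2 hp),
            mul_nonneg (sub_nonneg.2 hn2) (sub_nonneg.2 hq.le), mul_nonneg (sub_nonneg.2 hn2) (sub_nonneg.2 hp), hsqU])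
          (by nlinarith only [mul_nonneg (sub_nonneg.2 hn1) (sub_nonneg.2 hq.le), mul_nonneg (sub_nonneg.2 hn1) (sub_nonneg.2 hp),
            mul_nonneg (sub_nonneg.2 hn2) (sub_nonneg.2 hq.le), mul_nonneg (sub_nonneg.2 hn2) (sub_nonneg.2 hp), hsqU]))
  · -- near side of the anchor: cap `−0.2813417849 + 1.6212·t′` at `n = 7/8`
    have hA := laLow_cap78_near h445 h6 (by norm_num) hp.le
    have hcap := laLow_chord_78_one (n := n) h6 hA hC h78 h1
    rcases le_or_gt t' (-1 / 5) with hq | hq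
    · -- piece `(-1/4, -1/5]`
      have hfl := objE_floor_between hn0 hn2' (by norm_num : (-1 / 4 : ℝ) ≤ -1 / 5) rc rd hp.le hq
      exact doccN_lt_of_capUc_threshold (U₁ := 59 / 10) (Uc := 6) (by norm_num) (by norm_num) hU hn0 hn2' hcap hfl
        (sub_min_lt_of
          (by nlinarith only [mul_nonneg (sub_nonneg.2 hn1) (sub_nonneg.2 hp.le), mul_nonneg (sub_nonneg.2 hn1) (sub_nonneg.2 hq),
            mul_nonneg (sub_nonneg.2 hn2) (sub_nonneg.2 hp.le), mul_nonneg (sub_nonneg.2 hn2) (sub_nonneg.2 hq), hsqU])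
          (by nlinarith only [mul_nonneg (sub_nonneg.2 hn1) (sub_nonneg.2 hp.le), mul_nonneg (sub_nonneg.2 hn1) (sub_nonneg.2 hq),
            mul_nonneg (sub_nonneg.2 hn2) (sub_nonneg.2 hp.le), mul_nonneg (sub_nonneg.2 hn2) (sub_nonneg.2 hq), hsqU]))
    · -- piece `(-1/5, -17/100]`
      have hfl := objE_floor_between hn0 hn2' (by norm_num : (-1 / 5 : ℝ) ≤ -17 / 100) rd re hq.le ht2
      exact doccN_lt_of_capUc_threshold (U₁ := 59 / 10) (Uc := 6) (by norm_num) (by norm_num) hU hn0 hn2' hcap hfl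
        (sub_min_lt_of
          (by nlinarith only [mul_nonneg (sub_nonneg.2 hn1) (sub_nonneg.2 hq.le), mul_nonneg (sub_nonneg.2 hn1) (sub_nonneg.2 ht2),
            mul_nonneg (sub_nonneg.2 hn2) (sub_nonneg.2 hq.le), mul_nonneg (sub_nonneg.2 hn2) (sub_nonneg.2 ht2), hsqU])
          (by nlinarith only [mul_nonneg (sub_nonneg.2 hn1) (sub_nonneg.2 hq.le), mul_nonneg (sub_nonneg.2 hn1) (sub_nonneg.2 ht2),
            mul_nonneg (sub_nonneg.2 hn2) (sub_nonneg.2 hq.le), mul_nonneg (sub_nonneg.2 hn2) (sub_nonneg.2 ht2), hsqU]))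

end Summit.Ventures.CertifiedManyBodySolver.Observables

end
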